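import Summits.QuantumFields.YangMills.Theses.LangevinControlUV
import Summits.QuantumFields.YangMills.Theorems.FemtoCurvatureTwoPoint.Negative.ForcedDividend
import Summits.QuantumFields.YangMills.Theorems.FemtoCurvatureTwoPoint.Negative.UnfaithfulFalse
import HarnessLib.Audit

/-!
# Line `cosh-mixture-convexity` — crux `FemtoCurvatureTwoPoint` (stmt-QuantumFields-9363),
# route `LangevinControlUV`

CRUX-PLAN skeleton (planner `cruxplan-stmt-QuantumFields-9363-cosh-mixture-convexity`, round 1; card
`Ideas/cosh-mixture-convexity.md`, merged by triage r1-2/r1-3 with `transverse-gram-domination`: one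
"transfer-matrix positivity" reduction layer).

**The line.** Slice the torus `(ℤ/L)⁴` along a coordinate direction `μ`. Wilson's transfer operator
`T = M^{1/2} Π_G 𝒦 Π_G M^{1/2}` is POSITIVE and self-adjoint for every compact `G`, unitary `ρ`, `β ≥ 0`
and every `L` (its crossing kernel `exp(β Re⟨ρ g, ρ h⟩_HS)` is a Schur exponential of a Gram kernel;
Lüscher 1977, Osterwalder–Seiler 1978 §2, Seiler LNP 159 Ch. 2, Montvay–Münster §3.2.8). Hence every
DIAGONAL plaquette covariance profile `s ↦ F^{ij}_μ(s) = Cov(P_0^{ij}, P_{s e_μ}^{ij})` is a positive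
cosh-mixture `Z⁻¹ Σ_{a,b} λ_a^{L-s} λ_b^{s} |A_{ab}|²` (for plaquettes containing `e_μ`: a mixture in `s - 1`
over `[0, L-2]`, plus `F(0) = Var P ≥ F(1)` by Cauchy–Schwarz) — in particular NON-INCREASING on
`[0, L/2]` (`stub_profileAntitone`); and the Hilbert–Schmidt Cauchy–Schwarz inequality for the positive
forms `(X, Y) ↦ Tr(T^a X* T^b Y)` bounds EVERY plaquette pair by the geometric mean of two diagonal
profiles at separation `≥ m - 1`, `m = max_ν |(x - y)_ν| ≥ dist/2` (`stub_offAxisDomination`). With these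
two structural facts the crux follows — by the sorry-free real-analysis composition
`FemtoCurvatureTwoPoint_of` below — from the ENGINE statement `stub_dyadicDiagonalEngine` (the card's
transfer target `C⁺ = DyadicDiagonalTwoPoint`, sharpened as the triage panel asked): a unit map `a` and a
MONOTONE shape `Γ` with
  (A) the LOWER axis bound `c Γ(2^k a) ≤ 2^{8k} Cov(P_0^{01}, P_{2^k e₂}^{01})` at DYADIC separations up
      to `L/4` (one octave above the crux's range `L/8`: TRIAGE-r1-1 sharpen (2), r1-2/r1-3 GAP 1),
  (B) dyadic UPPER bounds `2^{8k} F^{ij}_μ(2^k) ≤ C Γ(2^k a)` for all `24` diagonal families up to `L/2`,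
  (V) the variance bound `Var P^{ij} ≤ C Γ(a)`,
on every femto torus. Monotonicity of `Γ` (physically `Γ ≍ ḡ⁴`, increasing) is the regularity the panel
required (window-doubling / `MonotoneOn`; r1-1 sharpen (1)) and is what turns dyadic anchors into the
crux's pointwise clause and separation `m - 1` into `dist`; it also closes the generic-step loophole of
the typed crux for THIS line (a monotone `Γ` two-sidedly pinned on the largest femto torus cannot be fed by
fixed-torus freezing asymptotics alone — Disproof `tendsto_gamma_nhdsWithin_zero`: the engine must exhibit
`Γ(0⁺) = 0`, i.e. asymptotic freedom of the curvature two-point function).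

**Disproof used** (`Cruxes/FemtoCurvatureTwoPoint/Disproof.lean`, cdisprove gen 1 v3): `§ UpperOnly`
(`exists_upperOnlyWith`: the LOWER clause is the unique load-bearing one) — it is isolated here as clause
(A) of the engine, everything else being upper bounds; `not_packageRho_one` (faithfulness load-bearing) —
the engine is stated over `LatticeRep` (faithful), the structural stubs hold for every unitary `ρ`;
`tendsto_gamma` / `not_packageWith_const` / `tendsto_gamma_nhdsWithin_zero` (forced dividend; under
`MonotoneOn Γ`, `Γ(0⁺) = 0`) — honoured: no floor on `Γ` is asserted, and the line card records that the
engine must deliver asymptotic freedom; `§ Resists 3` / landed `Negative.FiniteGroup*` (`ConnectedSpace`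
load-bearing) — the engine keeps `IsCompactSimpleLieGroup G`; `not_packageRho_of_frequently_nonpos` (sign
kill switch) — answered in sign by `T ≥ 0` (the same spectral representation gives `F ≥ 0`; only
monotonicity is load-bearing below). No `_false_without_` theorem is stated in the Disproof; no stub is an
instance of a landed Negative lemma (checked against `Negative.UpperOnly`, `ForcedDividend`,
`UnfaithfulFalse`, `PlaquetteFreezing`, `FiniteGroupPeierls/Vortices`).

Layout: § Defs (the crux unbundled, `femtoCurvatureTwoPoint_iff : … := Iff.rfl`, as in the Disproof) ·
§ Sig (the three stub signatures + the engine predicate) · § Stubs (registered `stub_*`, `sorry`) ·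
§ Glue (sorry-free: dyadic bracketing, lower/upper axis bounds, one-factor all-pairs bound, assembly) ·
§ Negative checks (`engine_forces_dividend`, `engine_trivialRep_false`) · `FemtoCurvatureTwoPoint_of`.
-/

noncomputable section

open scoped Matrix
open Filter Topology MeasureTheory
open Literature.MathematicalPhysics.QuantumFieldTheory
open Summit.QuantumFields.YangMills.Theses.LangevinControlUV (FemtoCurvatureTwoPoint)

namespace Summit.QuantumFields.YangMills.Cruxes.FemtoCurvatureTwoPoint.CoshMixtureConvexity

/-! ## § Defs — the crux vocabulary, definitional with the `let`s of `FemtoCurvatureTwoPoint` -/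

section Defs

variable {G : Type} [Group G] [TopologicalSpace G] [IsTopologicalGroup G] [CompactSpace G]
  [MeasurableSpace G] [BorelSpace G] {N : ℕ}

/-- The plaquette field `P_x^{ij}(U) = N - Re tr ρ(U_{p(x;i,j)})` (the crux's `let P`). -/
def plaq (ρ : G →* Matrix (Fin N) (Fin N) ℂ) {L : ℕ} (x : Site 4 L) (i j : Fin 4)
    (U : GaugeConfig 4 L G) : ℝ :=
  (N : ℝ) - (ρ (plaquetteHolonomy U x i j)).trace.re

/-- Covariance under Wilson's measure (the crux's `let cov`, `let E`). -/
def cov (ρ : G →* Matrix (Fin N) (Fin N) ℂ) {L : ℕ} [NeZero L] (β : ℝ)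
    (F F' : GaugeConfig 4 L G → ℝ) : ℝ :=
  wilsonExpectation (d := 4) (L := L) ρ β (fun U => F U * F' U) -
    wilsonExpectation (d := 4) (L := L) ρ β F * wilsonExpectation (d := 4) (L := L) ρ β F'

/-- Torus Euclidean distance (the crux's `let dist`). -/
def tdist {L : ℕ} (x y : Site 4 L) : ℝ :=
  Real.sqrt (∑ k : Fin 4, (((x k - y k).valMinAbs : ℤ) : ℝ) ^ 2)

/-- **Diagonal covariance profile** of the plane type `(i, j)` along the direction `μ`:
`F^{ij}_μ(s) = Cov(P_0^{ij}, P_{s e_μ}^{ij})` on the torus of side `L` (index `s : ℕ`, cast into `ℤ/L`).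
`F^{01}_2` is the crux's reference axis profile; `μ ∉ {i, j}` are the "multiplication-operator" families,
`μ ∈ {i, j}` the "kernel-insertion" families of the transfer-matrix picture. -/
def diag (ρ : G →* Matrix (Fin N) (Fin N) ℂ) (L : ℕ) [NeZero L] (β : ℝ) (i j μ : Fin 4) (s : ℕ) : ℝ :=
  cov ρ β (plaq ρ (0 : Site 4 L) i j) (plaq ρ (Pi.single μ ((s : ℕ) : ZMod L)) i j)

/-- The two clauses of the crux on ONE torus at ONE coupling, for data `(a, Γ, c, C)`. -/
def Clauses (ρ : G →* Matrix (Fin N) (Fin N) ℂ) (a Γ : ℝ → ℝ) (c C : ℝ) (L : ℕ) [NeZero L]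
    (β : ℝ) : Prop :=
  (∀ n : ℕ, 1 ≤ n → 8 * n ≤ L →
      c * Γ ((n : ℝ) * a β) ≤ (n : ℝ) ^ 8 * diag ρ L β 0 1 2 n ∧
        (n : ℝ) ^ 8 * diag ρ L β 0 1 2 n ≤ C * Γ ((n : ℝ) * a β)) ∧
    ∀ (x y : Site 4 L) (i j i' j' : Fin 4), x ≠ y → i ≠ j → i' ≠ j' →
      |cov ρ β (plaq ρ x i j) (plaq ρ y i' j')| * tdist x y ^ 8 ≤ C * Γ (tdist x y * a β)

/-- The crux package at a bare representation `ρ` with explicit data `(a, Γ, β₀, ℓ₀, c, C)`. -/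
def PackageWith (ρ : G →* Matrix (Fin N) (Fin N) ℂ) (a Γ : ℝ → ℝ) (β₀ ℓ₀ c C : ℝ) : Prop :=
  0 < ℓ₀ ∧ 0 < c ∧ (∀ β, 0 < a β) ∧ Tendsto a atTop (𝓝 0) ∧
    (∀ s : ℝ, 0 < s → s ≤ ℓ₀ → 0 < Γ s ∧ Γ s ≤ 1) ∧
      ∀ (L : ℕ) [NeZero L] (β : ℝ), β₀ ≤ β → (L : ℝ) * a β ≤ ℓ₀ → Clauses ρ a Γ c C L β

/-- The crux AT a fixed compact group and bare representation `ρ` (`∃` data). -/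
def PackageRho (ρ : G →* Matrix (Fin N) (Fin N) ℂ) : Prop :=
  ∃ (a : ℝ → ℝ), ∃ (Γ : ℝ → ℝ) (β₀ ℓ₀ c C : ℝ), PackageWith ρ a Γ β₀ ℓ₀ c C

end Defs

/-- The crux is literally `∀ G simple compact, ∀ r : LatticeRep G, PackageRho r.ρ` (definitional
unbundling of the `let`s; Borel σ-algebra as in the crux). -/
theorem femtoCurvatureTwoPoint_iff :
    FemtoCurvatureTwoPoint ↔
      ∀ (G : Type) [Group G] [TopologicalSpace G] [IsTopologicalGroup G] [CompactSpace G],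
        IsCompactSimpleLieGroup G →
          letI : MeasurableSpace G := borel G
          haveI : BorelSpace G := ⟨rfl⟩
          ∀ r : LatticeRep G, PackageRho r.ρ :=
  Iff.rfl

/-! ## § Sig — the stub signatures (Props named `Sig.stub_<name>`; layer audit: hypothesis heads of
`FemtoCurvatureTwoPoint_of` = stub names) and the engine predicate -/

section Sig

variable {G : Type} [Group G] [TopologicalSpace G] [IsTopologicalGroup G] [CompactSpace G]
  [MeasurableSpace G] [BorelSpace G] {N : ℕ}

/-- Monotonicity of every diagonal profile on `[0, L/2]` at `(G, ρ)`: for `β ≥ 0`, `i ≠ j`, every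
direction `μ` and `k ≤ n ≤ L/2`, `F^{ij}_μ(n) ≤ F^{ij}_μ(k)`. -/
def ProfileAntitoneAt (ρ : G →* Matrix (Fin N) (Fin N) ℂ) : Prop :=
  ∀ (L : ℕ) [NeZero L] (β : ℝ), 0 ≤ β → ∀ (i j μ : Fin 4), i ≠ j →
    ∀ (k n : ℕ), k ≤ n → 2 * n ≤ L → diag ρ L β i j μ n ≤ diag ρ L β i j μ k

/-- Off-axis domination at `(G, ρ)`: for `β ≥ 0` and every pair of genuine plaquettes at distinct base
points there are a slicing direction `μ`, the maximal displacement component `m` (`1 ≤ m ≤ L/2`,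
`m ≤ dist ≤ 2m`) and two folded separations `s, s' ∈ [m - 1, L/2]` with
`|Cov(P_x^{ij}, P_y^{i'j'})| ≤ √F^{ij}_μ(s) · √F^{i'j'}_μ(s')`. -/
def OffAxisDominationAt (ρ : G →* Matrix (Fin N) (Fin N) ℂ) : Prop :=
  ∀ (L : ℕ) [NeZero L] (β : ℝ), 0 ≤ β →
    ∀ (x y : Site 4 L) (i j i' j' : Fin 4), x ≠ y → i ≠ j → i' ≠ j' →
      ∃ (μ : Fin 4) (m s s' : ℕ), 1 ≤ m ∧ 2 * m ≤ L ∧ tdist x y ≤ 2 * (m : ℝ) ∧ (m : ℝ) ≤ tdist x y ∧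
        m ≤ s + 1 ∧ 2 * s ≤ L ∧ m ≤ s' + 1 ∧ 2 * s' ≤ L ∧
          |cov ρ β (plaq ρ x i j) (plaq ρ y i' j')| ≤
            Real.sqrt (diag ρ L β i j μ s) * Real.sqrt (diag ρ L β i' j' μ s')

/-- **The engine predicate** (the card's `C⁺ = DyadicDiagonalTwoPoint`, sharpened): data
`(a, Γ, β₀, ℓ₀, c, C)` with the crux's side conditions, `Γ` MONOTONE on `(0, ℓ₀]`, and on every femto
torus (`β ≥ β₀`, `L·a(β) ≤ ℓ₀`):
(A) the LOWER reference-axis bound at dyadic separations `2^k ≤ L/4` (tori `L ≥ 8` only),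
(B) UPPER bounds for every diagonal family `(i ≠ j, μ)` at dyadic separations `2^k ≤ L/2`,
(V) the variance bound `Var P^{ij} ≤ C Γ(a(β))`. -/
def EngineWith (ρ : G →* Matrix (Fin N) (Fin N) ℂ) (a Γ : ℝ → ℝ) (β₀ ℓ₀ c C : ℝ) : Prop :=
  0 < ℓ₀ ∧ 0 < c ∧ (∀ β, 0 < a β) ∧ Tendsto a atTop (𝓝 0) ∧
    (∀ s : ℝ, 0 < s → s ≤ ℓ₀ → 0 < Γ s ∧ Γ s ≤ 1) ∧ MonotoneOn Γ (Set.Ioc 0 ℓ₀) ∧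
      ∀ (L : ℕ) [NeZero L] (β : ℝ), β₀ ≤ β → (L : ℝ) * a β ≤ ℓ₀ →
        (∀ k : ℕ, 8 ≤ L → 4 * 2 ^ k ≤ L →
            c * Γ (((2 ^ k : ℕ) : ℝ) * a β) ≤ ((2 ^ k : ℕ) : ℝ) ^ 8 * diag ρ L β 0 1 2 (2 ^ k)) ∧
        (∀ (i j μ : Fin 4), i ≠ j → ∀ k : ℕ, 2 * 2 ^ k ≤ L →
            ((2 ^ k : ℕ) : ℝ) ^ 8 * diag ρ L β i j μ (2 ^ k) ≤ C * Γ (((2 ^ k : ℕ) : ℝ) * a β)) ∧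
        (∀ (i j : Fin 4), i ≠ j →
            cov ρ β (plaq ρ (0 : Site 4 L) i j) (plaq ρ (0 : Site 4 L) i j) ≤ C * Γ (a β))

/-- **Stub 1 — `stub_profileAntitone` (size M–L; provable now).** For every compact (second-countable)
`G`, continuous unitary `ρ : G → U(N)`, `β ≥ 0`, every torus `(ℤ/L)⁴`, every plane type `i ≠ j` and
direction `μ`, the diagonal profile `s ↦ Cov(P_0^{ij}, P_{s e_μ}^{ij})` is NON-INCREASING on `[0, L/2]`.
Why true: positivity of Wilson's transfer operator in direction `μ` (`T = M^{1/2}Π𝒦ΠM^{1/2} ≥ 0`, all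
`L`, no gauge fixing: `∫dV 𝒦∘R_V = 𝒦Π`, `𝒦` positive type) gives, with `A = P̂ - ⟨P⟩` (resp. the centred
kernel insertion `T_P - ⟨P⟩T`, self-adjoint since `Re tr U_p⁻¹ = Re tr U_p`),
`F(s) = Z⁻¹ Σ_{a,b} λ_a^{L-s} λ_b^{s} |A_{ab}|²` (`μ ∉ {i,j}`, `0 ≤ s ≤ L`) resp.
`Z⁻¹ Σ λ_a^{L-1-s} λ_b^{s-1} |(T_A)_{ab}|²` (`μ ∈ {i,j}`, `1 ≤ s ≤ L-1`): convex and symmetric about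
`L/2`, hence non-increasing up to `L/2`; the missing step `F(1) ≤ F(0) = Var P` is Cauchy–Schwarz plus
translation invariance. By-products NOT used by the glue: `F ≥ 0`, `F(s) = F(L-s)`, convexity and
log-convexity `F(s)² ≤ F(s-1)F(s+1)` (the card's title). Leans on: `wilsonExpectation`, `wilsonMeasure`
(tree), `wilsonExpectation_reflectionPositive_holds` / `_oddReflectionPositive` (even/odd torus RP, the
`T ≥ 0` statement in RP clothing), Ising template `Literature.Probability.LatticeModels` torus transfer
spectral files, Mathlib `MeasureTheory.integral_prod`, `ContinuousLinearMap.IsPositive`; sibling item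
`XiCompleteMonotonicity.AxialLogConvexity` (stmt-QuantumFields-8940, infinite-volume analogue). -/
def Sig.stub_profileAntitone : Prop :=
  ∀ (G : Type) [Group G] [TopologicalSpace G] [IsTopologicalGroup G] [CompactSpace G]
    [MeasurableSpace G] [BorelSpace G] [SecondCountableTopology G] (N : ℕ)
    (ρ : G →* Matrix (Fin N) (Fin N) ℂ), Continuous ρ →
      (∀ g, ρ g ∈ Matrix.unitaryGroup (Fin N) ℂ) → ProfileAntitoneAt ρ

/-- **Stub 2 — `stub_offAxisDomination` (size M–L; provable now).** For every compact `G`, continuous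
unitary `ρ`, `β ≥ 0`, torus `(ℤ/L)⁴` and plaquettes `P_x^{ij}`, `P_y^{i'j'}` with `x ≠ y`: let `μ` be a
direction of maximal displacement `m = |(x-y)_μ|_{ℤ/L} ≥ 1` (so `m ≤ dist(x,y) ≤ 2m ≤ L`); then
`|Cov(P_x^{ij}, P_y^{i'j'})| ≤ √F^{ij}_μ(s) √F^{i'j'}_μ(s')` for some folded separations
`s, s' ∈ [m-1, L/2]`. Why true: Hilbert–Schmidt Cauchy–Schwarz
`|Tr(T^a X T^b Y)| ≤ ‖T^{p}XT^{q}‖_HS ‖T^{q'}Y'T^{p'}‖_HS` for the positive transfer operator in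
direction `μ`, with centred insertions (`0`-step multiplication operators for `μ ∉` plane, `1`-step
kernel insertions for `μ ∈` plane, a half-step `T^{1/2}YT^{1/2}` absorbing the mixed case); the two
diagonal traces are torus expectations at separations `s + s' ∈ {2m-1, 2m, 2m+1}` (choose `s, s' ≥ m-1`;
fold `s ↦ L-s` by translation invariance); the touching mixed case `m = 1` is plain Cauchy–Schwarz with
the variances (`s = s' = 0`). Even `L`: this is RP Cauchy–Schwarz (`LatticeRPCauchySchwarz.lean`,
`re_sum_pair_sq_le`) about site/link hyperplanes orthogonal to `e_μ`. Geometry: `dist² = Σ_ν v_ν² ≤ 4m²`,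
`|v_ν| ≤ L/2` (`ZMod.natAbs_valMinAbs_le`). -/
def Sig.stub_offAxisDomination : Prop :=
  ∀ (G : Type) [Group G] [TopologicalSpace G] [IsTopologicalGroup G] [CompactSpace G]
    [MeasurableSpace G] [BorelSpace G] [SecondCountableTopology G] (N : ℕ)
    (ρ : G →* Matrix (Fin N) (Fin N) ℂ), Continuous ρ →
      (∀ g, ρ g ∈ Matrix.unitaryGroup (Fin N) ℂ) → OffAxisDominationAt ρ

/-- **Stub 3 — `stub_dyadicDiagonalEngine` (the HARDEST stub: open-problem sized; the line's transfer
target `C⁺`).** For every compact simple `G` and faithful unitary `r` there are a unit map `a > 0`,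
`a → 0`, a shape `Γ ∈ (0, 1]`, MONOTONE on `(0, ℓ₀]`, and `β₀, ℓ₀, c > 0, C` with, on every femto torus:
(A) `c Γ(2^k a) ≤ 2^{8k} Cov(P_0^{01}, P_{2^k e₂}^{01})` for `4·2^k ≤ L` — ONE two-sided-type estimate per
octave, lower half only, sign supplied by Stub 1's spectral representation, no estimate at non-dyadic or
`n ≤ 3` separations; (B) `2^{8k} Cov(P_0^{ij}, P_{2^k e_μ}^{ij}) ≤ C Γ(2^k a)` for all `i ≠ j`, `μ`,
`2·2^k ≤ L` (upper bounds only, `24` reflection-symmetric families = squared norms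
`‖T^{s/2} A Ω‖²`-type quantities); (V) `Var P^{ij} ≤ C Γ(a)`. Why it might fail / what it costs: this IS
the cutoff-uniform control of a dimension-8 composite in femto boxes ("Bałaban with observables") — any
engine (the route's Boué–Dupuis value, cards local-coupling-hessian / deep-band-gaussian-regime as
rungs) must produce `Γ ≍ ḡ⁴` with `Γ(0⁺) = 0` (Disproof `tendsto_gamma_nhdsWithin_zero`: forced by
monotonicity + freezing); the monotone `Γ` excludes the parasitic generic-step witnesses of the typed
crux. Sources: Balaban1988Convergent, MagnenRivasseauSeneor1993, BarashkovGubinelli2020, Luscher1983,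
LuscherWeisz2011, MontvayMunster1994 §5.1. -/
def Sig.stub_dyadicDiagonalEngine : Prop :=
  ∀ (G : Type) [Group G] [TopologicalSpace G] [IsTopologicalGroup G] [CompactSpace G],
    IsCompactSimpleLieGroup G →
      letI : MeasurableSpace G := borel G
      haveI : BorelSpace G := ⟨rfl⟩
      ∀ r : LatticeRep G, ∃ (a Γ : ℝ → ℝ) (β₀ ℓ₀ c C : ℝ), EngineWith r.ρ a Γ β₀ ℓ₀ c C

end Sig

/-! ## § Stubs — the registered obligations -/

theorem stub_profileAntitone : Sig.stub_profileAntitone := by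
  sorry

theorem stub_offAxisDomination : Sig.stub_offAxisDomination := by
  sorry

theorem stub_dyadicDiagonalEngine : Sig.stub_dyadicDiagonalEngine := by
  sorry

/-! ## § Glue — sorry-free: dyadic data + monotone profiles + off-axis domination ⇒ the crux package -/

section Glue

variable {G : Type} [Group G] [TopologicalSpace G] [IsTopologicalGroup G] [CompactSpace G]
  [MeasurableSpace G] [BorelSpace G] {N : ℕ} {ρ : G →* Matrix (Fin N) (Fin N) ℂ}

omit [TopologicalSpace G] [IsTopologicalGroup G] [CompactSpace G] [MeasurableSpace G] [BorelSpace G] in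
/-- Dyadic bracketing: every `n ≥ 1` lies in `[2^k, 2^{k+1})`. -/
theorem exists_dyadic {n : ℕ} (hn : 1 ≤ n) : ∃ k : ℕ, 2 ^ k ≤ n ∧ n < 2 * 2 ^ k := by
  refine ⟨Nat.log 2 n, Nat.pow_log_le_self 2 (by omega), ?_⟩
  have h := Nat.lt_pow_succ_log_self (b := 2) (by norm_num) n
  rw [pow_succ] at h
  omega

/-- The profile at separation `0` is the variance. -/
theorem diag_zero (L : ℕ) [NeZero L] (β : ℝ) (i j μ : Fin 4) :
    diag ρ L β i j μ 0 = cov ρ β (plaq ρ (0 : Site 4 L) i j) (plaq ρ (0 : Site 4 L) i j) := by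
  simp only [diag, Nat.cast_zero, Pi.single_zero]

/-- **The composition at fixed `(G, ρ)`.** Monotone profiles + off-axis domination + the dyadic engine
data `(a, Γ, β₀, ℓ₀, c, C)` give the crux package with data `(a, Γ, max β₀ 0, ℓ₀, c/2⁸, 8⁸|C|)`:
* clause 1, lower: `n ∈ [2^k, 2^{k+1})`, anchor `J = 2^{k+1} ≤ 2n ≤ L/4`; `F(n) ≥ F(J) ≥ cΓ(Ja)/J⁸ > 0`
  and `Γ(na) ≤ Γ(Ja)` (monotone), so `n⁸F(n) ≥ 2⁻⁸ c Γ(na)`;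
* clause 1, upper (and every family, `n ≤ L/2`): anchor `K = 2^k ≤ n`; `F(n) ≤ F(K) ≤ CΓ(Ka)/K⁸`,
  `Γ(Ka) ≤ Γ(na)`, so `n⁸F(n) ≤ 2⁸|C|Γ(na)`;
* clause 2: `|Cov| ≤ √F(s)√F'(s')` with `s, s' ≥ m-1`; `F(s) ≤ F(m-1)`; for `m ≥ 2` the upper bound at
  `t = m-1 ≤ dist ≤ 4t` gives `dist⁸F(s) ≤ 4⁸·2⁸|C|Γ(dist·a)`, for `m = 1` the variance bound and
  `dist ≤ 2` give `dist⁸F(s) ≤ 2⁸|C|Γ(dist·a)`; multiply the square roots. -/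
theorem packageWith_of_engine (hanti : ProfileAntitoneAt ρ) (hoff : OffAxisDominationAt ρ)
    {a Γ : ℝ → ℝ} {β₀ ℓ₀ c C : ℝ} (hE : EngineWith ρ a Γ β₀ ℓ₀ c C) :
    PackageWith ρ a Γ (max β₀ 0) ℓ₀ (c / 256) (8 ^ 8 * |C|) := by
  obtain ⟨hℓ, hc, ha, hat, hΓ, hmono, hcl⟩ := hE
  refine ⟨hℓ, by positivity, ha, hat, hΓ, ?_⟩
  intro L _ β hβ hLa
  have hβ0 : β₀ ≤ β := (le_max_left _ _).trans hβ
  have hβnn : 0 ≤ β := (le_max_right _ _).trans hβ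
  obtain ⟨hA, hB, hV⟩ := hcl L β hβ0 hLa
  have haβ : 0 < a β := ha β
  have hL1 : 1 ≤ L := Nat.one_le_iff_ne_zero.2 (NeZero.ne L)
  -- arguments `d · a(β)` with `1 ≤ d ≤ L` lie in the domain `(0, ℓ₀]` of `Γ`
  have hmemR : ∀ d : ℝ, 1 ≤ d → d ≤ L → d * a β ∈ Set.Ioc 0 ℓ₀ := fun d hd1 hdL =>
    ⟨mul_pos (by linarith) haβ, (mul_le_mul_of_nonneg_right hdL haβ.le).trans hLa⟩
  have hmem : ∀ t : ℕ, 1 ≤ t → t ≤ L → (t : ℝ) * a β ∈ Set.Ioc 0 ℓ₀ := fun t ht1 htL =>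
    hmemR t (by exact_mod_cast ht1) (by exact_mod_cast htL)
  have hΓpos : ∀ s ∈ Set.Ioc (0 : ℝ) ℓ₀, 0 < Γ s := fun s hs => (hΓ s hs.1 hs.2).1
  -- UPPER bound for every diagonal family at every separation `1 ≤ n ≤ L/2`
  have upper : ∀ (i j μ : Fin 4), i ≠ j → ∀ n : ℕ, 1 ≤ n → 2 * n ≤ L →
      (n : ℝ) ^ 8 * diag ρ L β i j μ n ≤ 256 * |C| * Γ ((n : ℝ) * a β) := by
    intro i j μ hij n hn h2n
    obtain ⟨k, hk, hk'⟩ := exists_dyadic hn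
    have hBk := hB i j μ hij k (by omega)
    have hantiK := hanti L β hβnn i j μ hij (2 ^ k) n hk h2n
    have hK1 : 1 ≤ 2 ^ k := Nat.one_le_two_pow
    generalize hK : 2 ^ k = K at hk hk' hBk hantiK hK1
    have hmemK := hmem K hK1 (by omega)
    have hmemn := hmem n hn (by omega)
    have hΓKn : Γ ((K : ℝ) * a β) ≤ Γ ((n : ℝ) * a β) :=
      hmono hmemK hmemn (mul_le_mul_of_nonneg_right (by exact_mod_cast hk) haβ.le)
    have hΓn0 : 0 < Γ ((n : ℝ) * a β) := hΓpos _ hmemn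
    have hΓK0 : 0 ≤ Γ ((K : ℝ) * a β) := (hΓpos _ hmemK).le
    have hn8 : (0 : ℝ) ≤ (n : ℝ) ^ 8 := by positivity
    by_cases hdK : diag ρ L β i j μ K ≤ 0
    · have h1 : (n : ℝ) ^ 8 * diag ρ L β i j μ n ≤ 0 := mul_nonpos_iff.2 (Or.inl ⟨hn8, hantiK.trans hdK⟩)
      have h2 : 0 ≤ 256 * |C| * Γ ((n : ℝ) * a β) := by positivity
      linarith
    · have hdK : 0 < diag ρ L β i j μ K := lt_of_not_ge hdK
      have hnK : (n : ℝ) ≤ 2 * K := by exact_mod_cast hk'.le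
      have hpow : (n : ℝ) ^ 8 ≤ (2 * (K : ℝ)) ^ 8 := pow_le_pow_left₀ (by positivity) hnK 8
      calc (n : ℝ) ^ 8 * diag ρ L β i j μ n ≤ (n : ℝ) ^ 8 * diag ρ L β i j μ K :=
            mul_le_mul_of_nonneg_left hantiK hn8
        _ ≤ (2 * (K : ℝ)) ^ 8 * diag ρ L β i j μ K := mul_le_mul_of_nonneg_right hpow hdK.le
        _ = 256 * ((K : ℝ) ^ 8 * diag ρ L β i j μ K) := by ring
        _ ≤ 256 * (C * Γ ((K : ℝ) * a β)) := by linarith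
        _ ≤ 256 * (|C| * Γ ((K : ℝ) * a β)) := by nlinarith [le_abs_self C]
        _ ≤ 256 * (|C| * Γ ((n : ℝ) * a β)) := by
            nlinarith [mul_le_mul_of_nonneg_left hΓKn (abs_nonneg C)]
        _ = 256 * |C| * Γ ((n : ℝ) * a β) := by ring
  -- LOWER bound for the reference axis profile at every `1 ≤ n ≤ L/8`
  have lower : ∀ n : ℕ, 1 ≤ n → 8 * n ≤ L →
      c / 256 * Γ ((n : ℝ) * a β) ≤ (n : ℝ) ^ 8 * diag ρ L β 0 1 2 n := by
    intro n hn h8n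
    obtain ⟨k, hk, hk'⟩ := exists_dyadic hn
    have hAk := hA (k + 1) (by omega) (by rw [pow_succ]; omega)
    have hantiJ := hanti L β hβnn 0 1 2 (by decide) n (2 ^ (k + 1)) (by rw [pow_succ]; omega)
      (by rw [pow_succ]; omega)
    have hJn : n ≤ 2 ^ (k + 1) := by rw [pow_succ]; omega
    have hJ2n : 2 ^ (k + 1) ≤ 2 * n := by rw [pow_succ]; omega
    generalize hJ : 2 ^ (k + 1) = J at hAk hantiJ hJn hJ2n
    have hJ1 : 1 ≤ J := hn.trans hJn
    have hJL : J ≤ L := by omega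
    have hmemJ := hmem J hJ1 hJL
    have hmemn := hmem n hn (by omega)
    have hΓnJ : Γ ((n : ℝ) * a β) ≤ Γ ((J : ℝ) * a β) :=
      hmono hmemn hmemJ (mul_le_mul_of_nonneg_right (by exact_mod_cast hJn) haβ.le)
    have hΓJ0 : 0 < Γ ((J : ℝ) * a β) := hΓpos _ hmemJ
    have hJ8 : (0 : ℝ) < (J : ℝ) ^ 8 := by positivity
    have hdJ : 0 < diag ρ L β 0 1 2 J := by
      by_contra h
      have h1 : (J : ℝ) ^ 8 * diag ρ L β 0 1 2 J ≤ 0 :=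
        mul_nonpos_iff.2 (Or.inl ⟨hJ8.le, le_of_not_gt h⟩)
      have h2 : 0 < c * Γ ((J : ℝ) * a β) := mul_pos hc hΓJ0
      linarith
    have hJle : (J : ℝ) ≤ 2 * n := by exact_mod_cast hJ2n
    have hpow : (J : ℝ) ^ 8 ≤ (2 * (n : ℝ)) ^ 8 := pow_le_pow_left₀ (by positivity) hJle 8
    have hn8 : (0 : ℝ) ≤ (n : ℝ) ^ 8 := by positivity
    calc c / 256 * Γ ((n : ℝ) * a β) ≤ c / 256 * Γ ((J : ℝ) * a β) :=
          mul_le_mul_of_nonneg_left hΓnJ (by positivity)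
      _ ≤ (J : ℝ) ^ 8 * diag ρ L β 0 1 2 J / 256 := by linarith
      _ ≤ (2 * (n : ℝ)) ^ 8 * diag ρ L β 0 1 2 J / 256 := by
          have := mul_le_mul_of_nonneg_right hpow hdJ.le
          linarith
      _ = (n : ℝ) ^ 8 * diag ρ L β 0 1 2 J := by ring
      _ ≤ (n : ℝ) ^ 8 * diag ρ L β 0 1 2 n := mul_le_mul_of_nonneg_left hantiJ hn8
  refine ⟨fun n hn h8n => ⟨lower n hn h8n, ?_⟩, fun x y i j i' j' hxy hij hij' => ?_⟩
  · -- clause 1, upper half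
    have hup := upper 0 1 2 (by decide) n hn (by omega)
    have hΓ0 : 0 ≤ Γ ((n : ℝ) * a β) := (hΓpos _ (hmem n hn (by omega))).le
    have h : 256 * |C| * Γ ((n : ℝ) * a β) ≤ 8 ^ 8 * |C| * Γ ((n : ℝ) * a β) := by
      apply mul_le_mul_of_nonneg_right _ hΓ0
      exact mul_le_mul_of_nonneg_right (by norm_num) (abs_nonneg C)
    exact hup.trans h
  · -- clause 2: off-axis domination, then one-factor bounds, then square roots
    obtain ⟨μ, m, s, s', hm1, h2m, hd2m, hmd, hms, h2s, hms', h2s', hcs⟩ :=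
      hoff L β hβnn x y i j i' j' hxy hij hij'
    have hd0 : 0 ≤ tdist x y := Real.sqrt_nonneg _
    have hd1 : 1 ≤ tdist x y := le_trans (by exact_mod_cast hm1) hmd
    have hdL : tdist x y ≤ L := hd2m.trans (by exact_mod_cast h2m)
    have hmemd := hmemR (tdist x y) hd1 hdL
    have hΓd0 : 0 ≤ Γ (tdist x y * a β) := (hΓpos _ hmemd).le
    have hd8 : 0 ≤ tdist x y ^ 8 := by positivity
    -- one factor: `dist⁸ · F^{pq}_μ(u) ≤ 8⁸ |C| Γ(dist · a)` whenever `m - 1 ≤ u ≤ L/2`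
    have factor : ∀ (p q : Fin 4), p ≠ q → ∀ u : ℕ, m ≤ u + 1 → 2 * u ≤ L →
        tdist x y ^ 8 * diag ρ L β p q μ u ≤ 8 ^ 8 * |C| * Γ (tdist x y * a β) := by
      intro p q hpq u hmu h2u
      rcases Nat.lt_or_ge m 2 with hm | hm
      · -- `m = 1`: reduce to the variance
        have hm' : m = 1 := by omega
        subst hm'
        have hanti0 := hanti L β hβnn p q μ hpq 0 u (Nat.zero_le _) h2u
        rw [diag_zero] at hanti0
        have hVpq := hV p q hpq
        have hmem1 : a β ∈ Set.Ioc 0 ℓ₀ := by simpa using hmem 1 le_rfl hL1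
        have hΓa0 : 0 ≤ Γ (a β) := (hΓpos _ hmem1).le
        have hΓ1 : Γ (a β) ≤ Γ (tdist x y * a β) :=
          hmono hmem1 hmemd (le_mul_of_one_le_left haβ.le hd1)
        have hd2 : tdist x y ≤ 2 := by simpa using hd2m
        have hd8le : tdist x y ^ 8 ≤ 2 ^ 8 := pow_le_pow_left₀ hd0 hd2 8
        calc tdist x y ^ 8 * diag ρ L β p q μ u
            ≤ tdist x y ^ 8 * (|C| * Γ (tdist x y * a β)) := by
              apply mul_le_mul_of_nonneg_left _ hd8
              calc diag ρ L β p q μ u ≤ _ := hanti0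
                _ ≤ C * Γ (a β) := hVpq
                _ ≤ |C| * Γ (a β) := mul_le_mul_of_nonneg_right (le_abs_self C) hΓa0
                _ ≤ |C| * Γ (tdist x y * a β) := mul_le_mul_of_nonneg_left hΓ1 (abs_nonneg C)
          _ ≤ 2 ^ 8 * (|C| * Γ (tdist x y * a β)) :=
              mul_le_mul_of_nonneg_right hd8le (mul_nonneg (abs_nonneg C) hΓd0)
          _ ≤ 8 ^ 8 * |C| * Γ (tdist x y * a β) := by nlinarith [mul_nonneg (abs_nonneg C) hΓd0]
      · -- `m ≥ 2`: reduce to separation `t = m - 1 ≥ 1`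
        obtain ⟨t, rfl⟩ : ∃ t, m = t + 1 := ⟨m - 1, by omega⟩
        have ht1 : 1 ≤ t := by omega
        have htu : t ≤ u := by omega
        have h2t : 2 * t ≤ L := by omega
        have hantit := hanti L β hβnn p q μ hpq t u htu h2u
        have hup := upper p q μ hpq t ht1 h2t
        have hmemt := hmem t ht1 (by omega)
        have ht1R : (1 : ℝ) ≤ t := by exact_mod_cast ht1
        have hcast : ((t + 1 : ℕ) : ℝ) = (t : ℝ) + 1 := by push_cast; ring
        rw [hcast] at hd2m hmd
        have htd : (t : ℝ) ≤ tdist x y := by linarith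
        have hΓt : Γ ((t : ℝ) * a β) ≤ Γ (tdist x y * a β) :=
          hmono hmemt hmemd (mul_le_mul_of_nonneg_right htd haβ.le)
        have hd4t : tdist x y ≤ 4 * t := by linarith
        have hpow : tdist x y ^ 8 ≤ (4 * (t : ℝ)) ^ 8 := pow_le_pow_left₀ hd0 hd4t 8
        by_cases hdt : diag ρ L β p q μ t ≤ 0
        · have h1 : tdist x y ^ 8 * diag ρ L β p q μ u ≤ 0 :=
            mul_nonpos_iff.2 (Or.inl ⟨hd8, hantit.trans hdt⟩)
          have h2 : 0 ≤ 8 ^ 8 * |C| * Γ (tdist x y * a β) := by positivity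
          linarith
        · have hdt : 0 < diag ρ L β p q μ t := lt_of_not_ge hdt
          calc tdist x y ^ 8 * diag ρ L β p q μ u ≤ tdist x y ^ 8 * diag ρ L β p q μ t :=
                mul_le_mul_of_nonneg_left hantit hd8
            _ ≤ (4 * (t : ℝ)) ^ 8 * diag ρ L β p q μ t := mul_le_mul_of_nonneg_right hpow hdt.le
            _ = 4 ^ 8 * ((t : ℝ) ^ 8 * diag ρ L β p q μ t) := by ring
            _ ≤ 4 ^ 8 * (256 * |C| * Γ ((t : ℝ) * a β)) := by linarith
            _ ≤ 4 ^ 8 * (256 * |C| * Γ (tdist x y * a β)) := by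
                nlinarith [mul_le_mul_of_nonneg_left hΓt (abs_nonneg C)]
            _ = 8 ^ 8 * |C| * Γ (tdist x y * a β) := by ring
    have hF := factor i j hij s hms h2s
    have hF' := factor i' j' hij' s' hms' h2s'
    have hK0 : 0 ≤ 8 ^ 8 * |C| * Γ (tdist x y * a β) := by positivity
    have hsq : Real.sqrt (tdist x y ^ 8) = tdist x y ^ 4 := by
      rw [show tdist x y ^ 8 = (tdist x y ^ 4) ^ 2 by ring, Real.sqrt_sq (by positivity)]
    calc |cov ρ β (plaq ρ x i j) (plaq ρ y i' j')| * tdist x y ^ 8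
        ≤ (Real.sqrt (diag ρ L β i j μ s) * Real.sqrt (diag ρ L β i' j' μ s')) * tdist x y ^ 8 :=
          mul_le_mul_of_nonneg_right hcs hd8
      _ = Real.sqrt (tdist x y ^ 8 * diag ρ L β i j μ s) *
            Real.sqrt (tdist x y ^ 8 * diag ρ L β i' j' μ s') := by
          rw [Real.sqrt_mul hd8, Real.sqrt_mul hd8, hsq]; ring
      _ ≤ Real.sqrt (8 ^ 8 * |C| * Γ (tdist x y * a β)) *
            Real.sqrt (8 ^ 8 * |C| * Γ (tdist x y * a β)) :=
          mul_le_mul (Real.sqrt_le_sqrt hF) (Real.sqrt_le_sqrt hF') (Real.sqrt_nonneg _)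
            (Real.sqrt_nonneg _)
      _ = 8 ^ 8 * |C| * Γ (tdist x y * a β) := Real.mul_self_sqrt hK0

/-- The crux package at `(G, ρ)` from the three structural/engine inputs. -/
theorem packageRho_of_engine (hanti : ProfileAntitoneAt ρ) (hoff : OffAxisDominationAt ρ)
    {a Γ : ℝ → ℝ} {β₀ ℓ₀ c C : ℝ} (hE : EngineWith ρ a Γ β₀ ℓ₀ c C) : PackageRho ρ :=
  ⟨a, Γ, max β₀ 0, ℓ₀, c / 256, 8 ^ 8 * |C|, packageWith_of_engine hanti hoff hE⟩

end Glue

/-! ## § Negative checks — the stub set against the landed `Negative.*` lemmas of this crux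

Two consequences a prover of `stub_dyadicDiagonalEngine` must live with (kernel-checked here so that no
engine candidate refuted by a landed Negative lemma can be registered by mistake):
* `engine_forces_dividend` (`Negative.ForcedDividend`): with the monotone `Γ`, ANY data realising the
  engine at a compact `G` and continuous unitary `ρ` has `Γ(s) → 0` as `s → 0⁺` — asymptotic freedom of
  the curvature two-point function is asserted outright (Disproof `tendsto_gamma_nhdsWithin_zero`);
  in particular no constant or floored shape (`not_packageWith_const`) can serve.
* `engine_trivialRep_false` (`Negative.UnfaithfulFalse`): the engine is impossible for the trivial
  representation — faithfulness of `r : LatticeRep G` is load-bearing, and Stub 3 is where it is used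
  (Stubs 1–2 hold for every unitary `ρ`). -/

section NegativeChecks

variable {G : Type} [Group G] [TopologicalSpace G] [IsTopologicalGroup G] [CompactSpace G]
  [MeasurableSpace G] [BorelSpace G] {N : ℕ} {ρ : G →* Matrix (Fin N) (Fin N) ℂ}

open Summit.QuantumFields.YangMills.Theorems.FemtoCurvatureTwoPoint.Negative in
/-- **Check (ForcedDividend).** The engine's shape is asymptotically free: `Γ → 0` at `0⁺`. -/
theorem engine_forces_dividend [SecondCountableTopology G] (hρ : Continuous ρ)
    (hρu : ∀ g, ρ g ∈ Matrix.unitaryGroup (Fin N) ℂ) (hanti : ProfileAntitoneAt ρ)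
    (hoff : OffAxisDominationAt ρ) {a Γ : ℝ → ℝ} {β₀ ℓ₀ c C : ℝ}
    (hE : EngineWith ρ a Γ β₀ ℓ₀ c C) : Tendsto Γ (𝓝[>] 0) (𝓝 0) := by
  have hmono : MonotoneOn Γ (Set.Ioc 0 ℓ₀) := hE.2.2.2.2.2.1
  obtain ⟨hℓ, hc, ha, hat, hΓ, hcl⟩ := packageWith_of_engine hanti hoff hE
  exact ForcedDividend.tendsto_shape_nhdsWithin_zero_of_monotone ρ hρ hρu hℓ hc ha hat
    (fun s hs hs' => (hΓ s hs hs').1)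
    (fun L _ β hβ hLa n hn h8 => ((hcl L β hβ hLa).1 n hn h8).1) hmono

open Summit.QuantumFields.YangMills.Theorems.FemtoCurvatureTwoPoint.Negative in
/-- **Check (UnfaithfulFalse).** No data realise the engine for the trivial representation. -/
theorem engine_trivialRep_false
    (hanti : ProfileAntitoneAt (1 : G →* Matrix (Fin N) (Fin N) ℂ))
    (hoff : OffAxisDominationAt (1 : G →* Matrix (Fin N) (Fin N) ℂ)) {a Γ : ℝ → ℝ}
    {β₀ ℓ₀ c C : ℝ} (hE : EngineWith (1 : G →* Matrix (Fin N) (Fin N) ℂ) a Γ β₀ ℓ₀ c C) :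
    False := by
  obtain ⟨hℓ, hc, ha, hat, hΓ, hcl⟩ := packageWith_of_engine hanti hoff hE
  exact UnfaithfulFalse.lowerBound_trivialRep_false hℓ hc ha hat (fun s hs hs' => (hΓ s hs hs').1)
    (fun L _ β hβ hLa n hn h8 => ((hcl L β hβ hLa).1 n hn h8).1)

end NegativeChecks

/-! ## The line: Stubs 1, 2, 3 imply the crux `FemtoCurvatureTwoPoint` BY NAME -/

/-- **The composition.** `stub_profileAntitone → stub_offAxisDomination → stub_dyadicDiagonalEngine →
FemtoCurvatureTwoPoint`: at each compact simple `G` and faithful `r` (second countable via the faithful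
matrix embedding), unbundle the crux (`femtoCurvatureTwoPoint_iff`) and apply `packageRho_of_engine`. -/
theorem FemtoCurvatureTwoPoint_of :
    Sig.stub_profileAntitone → Sig.stub_offAxisDomination → Sig.stub_dyadicDiagonalEngine →
      FemtoCurvatureTwoPoint := by
  intro hanti hoff hE
  refine femtoCurvatureTwoPoint_iff.2 fun G _ _ _ _ hG => ?_
  letI : MeasurableSpace G := borel G
  haveI : BorelSpace G := ⟨rfl⟩
  intro r
  haveI : SecondCountableTopology G :=
    (r.continuous.isClosedEmbedding r.injective).isEmbedding.secondCountableTopology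
  obtain ⟨a, Γ, β₀, ℓ₀, c, C, h⟩ := hE G hG r
  exact packageRho_of_engine (hanti G r.N r.ρ r.continuous r.mem_unitary)
    (hoff G r.N r.ρ r.continuous r.mem_unitary) h

/-- The skeleton instantiated: the crux modulo the three registered stubs. -/
theorem FemtoCurvatureTwoPoint_skeleton : FemtoCurvatureTwoPoint :=
  FemtoCurvatureTwoPoint_of stub_profileAntitone stub_offAxisDomination stub_dyadicDiagonalEngine

end Summit.QuantumFields.YangMills.Cruxes.FemtoCurvatureTwoPoint.CoshMixtureConvexity

end
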